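import Summits.BirchSwinnertonDyer.Rank1Residual.X1.GoodLatticeExists
import Summits.BirchSwinnertonDyer.BirchSwinnertonDyer.Theorems.SchneiderFreeAdditiveX3AnomalousTwistRationalLine
import HarnessLib

/-!
# Route `SchneiderFreeAdditiveX3` (K1 door), the (G-ord, `e = 2`) cell AT `p = 3`, ANOMALOUS twists: THE KELLER–YIN-NORMALISED MEMBER EXISTS
# in every isogeny class — a globally minimal `W₁ ~ W` NONE of whose rational `3`-lines is unramified (hence none `D₃`-trivial)

Cell `bsd-schneider-ideate`, seat `bsd-schneider-door-c5` (prover, generation 32; assembly layer; `--supports` 19177, helper).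
PARTITION: board row B6 ∩ X3 ∩ sst-twist, `r = 1`, (G-ord, `e = 2`) half at `p = 3`, the 1 725 ANOMALOUS pairs — an UNCONDITIONAL structure
theorem removing the per-lattice hypothesis of FILES 11–15 (Keller–Yin arXiv:2410.23241's standing choice of lattice, Assumption 2.0.3 / §3.3:
«we choose the lattice such that `φ|_{G_p} ≠ 𝟙`»); types-the-object-of nothing; closes none of B6's cells (BSD NOT advanced).  bears_on: K1-door
(19177 r3 `GordTwoBranchIMC`).  FILE 16a of the anomalous-twin port.

## What
For `W/ℚ` globally minimal with an anomalous good-ordinary twist model `W = C • V^{(3*)}` (`V` globally minimal, `GoodOrd V 3`, `3 ∣ a₃(V) − 1`):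
* §1 `isRationalLine_range_and_not_unramified_of_ker_anomalousTwist` — THE LOCAL STEP: if `g : W[3] → W′[3]` is `Γ_ℚ`-equivariant with kernel a line
  UNRAMIFIED at `3`, then `g(W[3])` is a rational line of `W′` which is NOT unramified at `3`.  (Generation 31's local shape (B): at every `𝔓 ∣ 3`
  there is the `D_𝔓`-trivial line `L₀ ≤ W[3]` and a Kummer inertia element `τ` with `τ ≡ −1` on `W[3]/L₀`; an inertia-fixed line contains `2P`
  for its points `P`, hence equals `L₀`; if the image were unramified, `τQ − Q ∈ L₀` and `τQ + Q ∈ L₀` would put every `Q` in `L₀`.)  This REPLACES the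
  good-ordinary reduction line of cell `bsd-eis`'s `X1.GoodLatticeExists` (`isRationalLine_range_and_not_unramified_of_ker` +
  `exists_reductionLine_adicCompletionPrime`), which is not available at the ADDITIVE prime.
* §2 **`exists_isIsogenous_noUnramifiedLine_of_anomalousTwist`** — there is a globally minimal `W₁ ~ W` (over `ℚ`) NONE of whose rational `3`-lines
  is unramified at `3`: cell `bsd-eis`'s elementary isogeny-graph argument (`X1.GoodLatticeExists.exists_isIsogenous_noUnramifiedLine`, seat
  bsd-eis-ky gen 3: a `Γ_ℚ`-stable cyclic subgroup through the unramified line of MAXIMAL order, Shafarevich finiteness `bddAbove_setOf_stableCyclic`,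
  quotient onto a minimal model `exists_minimal_isogeny_ker_eq`) VERBATIM with §1 as the local step.
* §3 **`exists_isIsogenous_normalised_of_anomalousTwist`** — hence a globally minimal `W₁ ~ W` with Keller–Yin's ∀-normalisation «every rational `3`-line
  of `W₁` is `D₃`-non-trivial» (a `D_𝔓`-trivial line is `I_𝔓`-trivial).

HONEST FRAMING: UNCONDITIONAL kernel theorems (Galois bookkeeping over tree theorems: AEC III.4.12 / IX.6.2 discharges, `End_ℚ(E) = ℤ`, generation 31's
local lemmas); no named fact, no definition, no `sorry`; nothing about BSD; «closes rung: none».  The transport of FILE 15's per-pair theorems along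
`W ~ W₁` (cell predicates, twist model, Cassels) is FILE 16b.
References: K. Ribet, Invent. Math. 34 (1976) Prop. 2.1; Keller–Yin arXiv:2402.12781v2 Prop. 1.3.1, arXiv:2410.23241 Assumption 2.0.3 / §3.3;
[SilvermanAEC2009] III.4.12, IX.6.2, X.5.4; [Serre1972] §1.11; cell bsd-eis `X1/GoodLatticeExists.lean` (template, credited); this seat p707405 (gen 31 F1).
-/

set_option autoImplicit false
set_option linter.dupNamespace false

noncomputable section

open scoped Classical

open WeierstrassCurve NumberField IsDedekindDomain Literature.NumberTheory.EllipticCurves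
  Literature.NumberTheory.EllipticCurves.Rank1Residual
  Literature.NumberTheory.EllipticCurves.KellerYin2024
  Literature.NumberTheory.GaloisRepresentations Field
  Summit.BirchSwinnertonDyer.Rank1Residual Summit.BirchSwinnertonDyer.Rank1Residual.GaloisImage
  Summit.BirchSwinnertonDyer.Rank1Residual.X2.IsogenyLineType
  Summit.BirchSwinnertonDyer.Rank1Residual.X1.StableCyclicQuotient
  Summit.BirchSwinnertonDyer.BirchSwinnertonDyer.Theorems
  Summit.BirchSwinnertonDyer.BirchSwinnertonDyer.Theorems.ResidualLineRigidity
  Summit.BirchSwinnertonDyer.BirchSwinnertonDyer.Theorems.SchneiderFreeAdditiveX3.AnomalousTwistLocalLines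

namespace Summit.BirchSwinnertonDyer.BirchSwinnertonDyer.Theorems.SchneiderFreeAdditiveX3.AnomalousTwistNormalisedMember

variable {p : ℕ} [hp : Fact p.Prime]
variable {V W : WeierstrassCurve ℚ} [V.IsElliptic] [V.IsGloballyMinimal] [W.IsElliptic] [W.IsGloballyMinimal]

/-! ### §1 The local step at the additive prime: the image of `W[3]` modulo the unramified line is RAMIFIED -/

omit hp [W.IsElliptic] [W.IsGloballyMinimal] in
/-- `P + P ∈ L ⟹ P ∈ L` on `p`-torsion, `p = 3` (`2·(P + P) = (p + 1)·P = P`). [folklore] -/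
private theorem mem_of_add_self_mem (hp3 : p = 3) {L : AddSubgroup (geomTorsion W (p : ℤ))} {P : geomTorsion W (p : ℤ)}
    (h : P + P ∈ L) : P ∈ L := by
  have h0 := natCast_zsmul_eq_zero P
  have h2 : ((2 : ℕ) : ℤ) * 2 = ((p : ℕ) : ℤ) + 1 := by rw [hp3]; norm_num
  have key : ((2 : ℕ) : ℤ) • (P + P) = P := by
    rw [← two_zsmul, smul_smul, h2, add_zsmul, h0, one_zsmul, zero_add]
  rw [← key]
  exact L.zsmul_mem h _

omit [W.IsGloballyMinimal] in
/-- **The local step.**  `W = C • V^{(3*)}` with `V` globally minimal good ordinary anomalous at `3`; `g : W[3] → W′[3]` additive and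
`Γ_ℚ`-equivariant with kernel a line UNRAMIFIED at `3`.  Then `g(W[3])` is a rational `3`-line of `W′` which is NOT unramified at `3`.  With
generation 31's `L₀` and Kummer `τ ∈ I_𝔓` (`τ ≡ −1` on `W[3]/L₀`): a non-zero `P ∈ ker g` has `τP = P`, so `2P = τP + P ∈ L₀`, `P ∈ L₀`, `ker g = L₀`;
were the image unramified, every `Q` would have `τQ − Q ∈ ker g = L₀` and `τQ + Q ∈ L₀`, so `2Q ∈ L₀`, `Q ∈ L₀` — but `#W[3] = 9 > 3`.
[cite: KellerYin2024, §1.3 Prop. 1.3.1 (arXiv:2402.12781v2) (local shape)] [cite: SilvermanAEC2009, X.5 Cor. 5.4] [cite: GreenbergVatsal2000, §2 p. 28] -/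
theorem isRationalLine_range_and_not_unramified_of_ker_anomalousTwist {W' : WeierstrassCurve ℚ} [W'.IsElliptic]
    (hp3 : p = 3) (hV : GoodOrd V p) (hanom : (p : ℤ) ∣ V.frobeniusTrace p - 1)
    (C : VariableChange ℚ) (hC : C • V.quadraticTwist ((-1 : ℚ) ^ (p / 2) * p) = W)
    (g : geomTorsion W (p : ℤ) →+ geomTorsion W' (p : ℤ))
    (hg : ∀ (σ : absoluteGaloisGroup ℚ) (P : geomTorsion W (p : ℤ)), g (σ • P) = σ • g P)
    (hK : Nat.card g.ker = p) (hu : LineUnramifiedAt W p g.ker) :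
    IsRationalLine W' p g.range ∧ ¬ LineUnramifiedAt W' p g.range := by
  have hpP : p.Prime := hp.out
  have hE : Nat.card (geomTorsion W (p : ℤ)) = p ^ 2 := Rank1Residual.natCard_geomTorsion W p
  refine ⟨Rank1Residual.isRationalLine_range g hg hE hK, fun hun ↦ ?_⟩
  obtain ⟨v, hpv⟩ := ResidualLineRigidity.exists_heightOneSpectrum_natCast_mem hpP
  obtain ⟨𝔓, h𝔓⟩ := v.primesAbove_nonempty
  obtain ⟨L₀, hL₀, hfix, τ, hτI, hτ⟩ := exists_trivLine_of_anomalous_pStar_twist hp3 hV hanom C hC hpv h𝔓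
  -- `ker g = L₀`
  obtain ⟨P, hPK, hP0⟩ := exists_ne_zero_mem hK
  have hτP : τ • P = P := hu v hpv 𝔓 h𝔓 τ hτI P hPK
  have hPL : P ∈ L₀ := by
    refine mem_of_add_self_mem hp3 ?_
    have h := hτ P
    rwa [hτP] at h
  have hKL : g.ker = L₀ := eq_of_prime_card_of_mem hK hL₀ hP0 hPK hPL
  -- every `Q` lies in `L₀`: contradiction
  obtain ⟨Q, hQ⟩ := exists_not_mem_of_natCard_eq hL₀
  apply hQ
  have h1 : τ • Q - Q ∈ L₀ := by
    rw [← hKL, AddMonoidHom.mem_ker, map_sub, hg, hun v hpv 𝔓 h𝔓 τ hτI (g Q) ⟨Q, rfl⟩, sub_self]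
  have h2 : τ • Q + Q ∈ L₀ := hτ Q
  refine mem_of_add_self_mem hp3 ?_
  have h3 : Q + Q = (τ • Q + Q) - (τ • Q - Q) := by abel
  rw [h3]
  exact L₀.sub_mem h2 h1

/-! ### §2 The member with no unramified rational `3`-line exists (cell `bsd-eis`'s isogeny-graph argument, local step §1) -/

omit [W.IsElliptic] [W.IsGloballyMinimal] in
/-- `ℤ·x` is finite and `Γ_ℚ`-stable when `x` has finite order and `σx ∈ ℤx` for all `σ`. [folklore] -/
private theorem zmultiples_finite_stable {x : W.geomPoints} {n : ℕ} (hn : n ≠ 0)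
    (hord : addOrderOf x = n) (hstab : ∀ σ : absoluteGaloisGroup ℚ, σ • x ∈ AddSubgroup.zmultiples x) :
    (AddSubgroup.zmultiples x : Set W.geomPoints).Finite ∧
      ∀ (σ : absoluteGaloisGroup ℚ) (P : W.geomPoints), P ∈ AddSubgroup.zmultiples x →
        σ • P ∈ AddSubgroup.zmultiples x := by
  refine ⟨?_, fun σ P hP ↦ ?_⟩
  · have : Finite (AddSubgroup.zmultiples x) := by
      apply Nat.finite_of_card_ne_zero; rw [Nat.card_zmultiples, hord]; exact hn
    exact Set.toFinite _
  · obtain ⟨m, rfl⟩ := AddSubgroup.mem_zmultiples_iff.mp hP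
    rw [smul_comm σ m x]
    exact AddSubgroup.zsmul_mem _ (hstab σ) m

/-- **The member with NO unramified rational `3`-line exists in the isogeny class of the anomalous twist** (the twin, at the ADDITIVE prime, of
cell `bsd-eis`'s `X1.GoodLatticeExists.exists_isIsogenous_noUnramifiedLine` — its proof VERBATIM, credited, with the local step §1).  If `W` has an
unramified rational `3`-line `Φ`, take a `Γ_ℚ`-stable cyclic subgroup `ℤx ⊂ W(ℚ̄)` with `(ℤx)[3] = Φ` of MAXIMAL order `3^k`
(`bddAbove_setOf_stableCyclic`: Shafarevich) and `W₁ = W/ℤx` (globally minimal model, `exists_minimal_isogeny_ker_eq`); an unramified rational line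
`Ψ` of `W₁` would pull back either to a stable cyclic subgroup of order `3^{k+1}` (maximality) or to the image of `W[3]`, which is RAMIFIED (§1).
[cite: Ribet1976, Prop. 2.1] [cite: KellerYin2024, Prop. 1.3.1 and §1.4 (arXiv:2402.12781v2)] [cite: SilvermanAEC2009, Prop. III.4.12, Cor. IX.6.2] -/
theorem exists_isIsogenous_noUnramifiedLine_of_anomalousTwist (hp3 : p = 3) (hV : GoodOrd V p)
    (hanom : (p : ℤ) ∣ V.frobeniusTrace p - 1) (C : VariableChange ℚ) (hC : C • V.quadraticTwist ((-1 : ℚ) ^ (p / 2) * p) = W) :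
    ∃ (W₁ : WeierstrassCurve ℚ) (_ : W₁.IsElliptic) (_ : W₁.IsGloballyMinimal),
      IsIsogenous W W₁ ∧
        ∀ Φ : AddSubgroup (geomTorsion W₁ (p : ℤ)), IsRationalLine W₁ p Φ → ¬ LineUnramifiedAt W₁ p Φ := by
  have hp' : p.Prime := hp.out
  have hpz : Prime (p : ℤ) := Int.prime_iff_natAbs_prime.mpr (by simpa using hp')
  by_cases hex : ∃ Φ : AddSubgroup (geomTorsion W (p : ℤ)), IsRationalLine W p Φ ∧ LineUnramifiedAt W p Φ
  swap
  · push Not at hex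
    exact ⟨W, inferInstance, inferInstance, IsIsogenous.refl_holds W, hex⟩
  obtain ⟨Φ, hΦ, hu⟩ := hex
  -- the line `Φ' = Φ ⊂ E(ℚ̄)` and a generator
  set Φ' : AddSubgroup W.geomPoints := Φ.map (geomTorsion W (p : ℤ)).subtype with hΦ'
  have hΦ'card : Nat.card Φ' = p := X2.IsogenyQuotientLine.natCard_map_subtype hΦ
  obtain ⟨x₀, hx₀Φ, hx₀0, hx₀ord, hx₀gen⟩ := exists_generator_of_prime_card (p := p) Φ' hΦ'card
  -- the set of good orders is non-empty (k = 1) and bounded; take the maximum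
  let T : Set ℕ := {k : ℕ | ∃ x : W.geomPoints, addOrderOf x = p ^ k ∧
    (∀ σ : absoluteGaloisGroup ℚ, σ • x ∈ AddSubgroup.zmultiples x) ∧
      p ^ (k - 1) • x ∈ Φ' ∧ p ^ (k - 1) • x ≠ 0}
  have h1T : 1 ∈ T := by
    refine ⟨x₀, by rw [pow_one]; exact hx₀ord, fun σ ↦ ?_,
      by rw [Nat.sub_self, pow_zero, one_smul]; exact hx₀Φ, by rw [Nat.sub_self, pow_zero, one_smul]; exact hx₀0⟩
    rw [hx₀gen]
    obtain ⟨P, hP, rfl⟩ := hx₀Φ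
    exact ⟨σ • P, hΦ.2 σ P hP, rfl⟩
  have hbdd : BddAbove T := by
    refine BddAbove.mono (fun k hk ↦ ?_) (bddAbove_setOf_stableCyclic (V := W) (p := p))
    obtain ⟨x, h1, h2, -⟩ := hk
    exact ⟨x, h1, h2⟩
  obtain ⟨x, hxord, hxstab, hxΦ, hx0⟩ : sSup T ∈ T := Nat.sSup_mem ⟨1, h1T⟩ hbdd
  set k := sSup T with hk
  have hk1 : 1 ≤ k := le_csSup hbdd h1T
  -- `t = p^{k-1} x` generates `Φ'`, of order `p`
  set t : W.geomPoints := p ^ (k - 1) • x with ht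
  have htgen : AddSubgroup.zmultiples t = Φ' := by
    obtain ⟨t₁, -, -, ht₁ord, ht₁gen⟩ := exists_generator_of_prime_card (p := p) Φ' hΦ'card
    have := eq_of_prime_card_of_mem (p := p) (H₁ := AddSubgroup.zmultiples t) (H₂ := Φ') ?_ hΦ'card hx0
      (AddSubgroup.mem_zmultiples t) hxΦ
    · exact this
    · -- `ord t = p`: `t ∈ Φ'` non-zero
      rw [Nat.card_zmultiples]
      haveI : Finite Φ' := Nat.finite_of_card_ne_zero (by rw [hΦ'card]; exact hp'.ne_zero)
      have hdvd : addOrderOf (⟨t, hxΦ⟩ : Φ') ∣ p := by rw [← hΦ'card]; exact addOrderOf_dvd_natCard _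
      rw [AddSubgroup.addOrderOf_mk] at hdvd
      rcases (Nat.dvd_prime hp').mp hdvd with h | h
      · exact absurd (AddMonoid.addOrderOf_eq_one_iff.mp h) hx0
      · exact h
  have htord : addOrderOf t = p := by
    have h := congrArg (fun H : AddSubgroup W.geomPoints ↦ Nat.card H) htgen
    simp only [Nat.card_zmultiples] at h
    rw [h, hΦ'card]
  -- the quotient `E' = E/ℤx`
  obtain ⟨hfin, hst⟩ := zmultiples_finite_stable (W := W) (pow_ne_zero k hp'.ne_zero) hxord hxstab
  obtain ⟨W₁, hW₁, hW₁min, g, hker⟩ := exists_minimal_isogeny_ker_eq (AddSubgroup.zmultiples x) hfin hst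
  refine ⟨W₁, hW₁, hW₁min, ⟨g⟩, fun Ψ hΨ hunΨ ↦ ?_⟩
  -- a generator `q₀` of `Ψ` and a preimage `y`
  obtain ⟨q₀, hq₀Ψ, hq₀0, -, hq₀gen⟩ := exists_generator_of_prime_card (p := p) Ψ hΨ.1
  obtain ⟨y, hy⟩ := g.surjective (q₀ : W₁.geomPoints)
  -- `p y ∈ ker g = ℤ x`: `a x = p y`
  have hpy : (p : ℤ) • y ∈ g.toAddMonoidHom.ker := by
    rw [AddMonoidHom.mem_ker, map_zsmul, Isogeny.coe_toAddMonoidHom, hy]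
    have h0 : (p : ℤ) • (q₀ : W₁.geomPoints) = 0 := (Submodule.mem_torsionBy_iff (p : ℤ) _).mp q₀.2
    exact h0
  rw [hker] at hpy
  obtain ⟨a, ha⟩ := AddSubgroup.mem_zmultiples_iff.mp hpy
  -- `p^k x = 0`
  have hpkx : ((p : ℤ) ^ k) • x = 0 := by
    rw [← Nat.cast_pow, natCast_zsmul, ← hxord]; exact addOrderOf_nsmul_eq_zero x
  by_cases hdvd : (p : ℤ) ∣ a
  · ---------------------------------------------------------------- `p ∣ a`: then `E[p] ↠ Ψ` — ramified
    obtain ⟨a', rfl⟩ := hdvd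
    set z : W.geomPoints := y - a' • x with hz
    have hpz0 : (p : ℤ) • z = 0 := by
      rw [hz, smul_sub, ← ha, smul_smul]
      exact sub_self _
    have hzmem : z ∈ geomTorsion W (p : ℤ) := (Submodule.mem_torsionBy_iff (p : ℤ) _).mpr hpz0
    have hxker : x ∈ g.toAddMonoidHom.ker := by rw [hker]; exact AddSubgroup.mem_zmultiples x
    have hgz : g z = (q₀ : W₁.geomPoints) := by
      rw [hz, map_sub, map_zsmul, hy]
      rw [AddMonoidHom.mem_ker, Isogeny.coe_toAddMonoidHom] at hxker
      rw [hxker, smul_zero, sub_zero]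
    -- restrict `g` to `E[p]`; its kernel is `(ℤx)[p] = Φ`
    obtain ⟨g', hg'val, hg'⟩ := X2.IsogenyLineType.exists_restrict_torsion (p := p) g
    have hker' : g'.ker = Φ := by
      ext P
      rw [AddMonoidHom.mem_ker]
      constructor
      · intro hP
        have h1 : (P : W.geomPoints) ∈ g.toAddMonoidHom.ker := by
          rw [AddMonoidHom.mem_ker, Isogeny.coe_toAddMonoidHom, ← hg'val, hP]; rfl
        rw [hker] at h1
        obtain ⟨m, hm⟩ := AddSubgroup.mem_zmultiples_iff.mp h1
        -- `p^k ∣ p m` since `p (m x) = 0`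
        have hP0 : (p : ℤ) • (P : W.geomPoints) = 0 := (Submodule.mem_torsionBy_iff (p : ℤ) _).mp P.2
        have hdiv : (addOrderOf x : ℤ) ∣ p * m := by
          rw [addOrderOf_dvd_iff_zsmul_eq_zero, mul_smul, hm, hP0]
        rw [hxord, Nat.cast_pow] at hdiv
        obtain ⟨m', hm'⟩ : (p : ℤ) ^ (k - 1) ∣ m := by
          have hk' : k = (k - 1) + 1 := by omega
          have hdiv' : (p : ℤ) ^ (k - 1) * p ∣ m * p := by
            rw [hk', pow_succ, mul_comm (p : ℤ) m] at hdiv; exact hdiv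
          have hp0 : (p : ℤ) ≠ 0 := by exact_mod_cast hp'.ne_zero
          exact (mul_dvd_mul_iff_right hp0).mp hdiv'
        -- so `P = m' • t ∈ Φ'`
        have hPt : (P : W.geomPoints) ∈ Φ' := by
          rw [← htgen, AddSubgroup.mem_zmultiples_iff]
          refine ⟨m', ?_⟩
          rw [ht, ← hm, hm', mul_comm, mul_smul, ← Nat.cast_pow, natCast_zsmul]
        obtain ⟨Q, hQ, hQP⟩ := hPt
        have : Q = P := Subtype.ext hQP
        exact this ▸ hQ
      · intro hP
        have hPt : (P : W.geomPoints) ∈ Φ' := ⟨P, hP, rfl⟩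
        rw [← htgen, AddSubgroup.mem_zmultiples_iff] at hPt
        obtain ⟨m, hm⟩ := hPt
        have h1 : (P : W.geomPoints) ∈ g.toAddMonoidHom.ker := by
          rw [hker, AddSubgroup.mem_zmultiples_iff]
          exact ⟨m * (p : ℤ) ^ (k - 1), by rw [mul_smul, ← hm, ht, ← Nat.cast_pow, natCast_zsmul]⟩
        rw [AddMonoidHom.mem_ker, Isogeny.coe_toAddMonoidHom, ← hg'val] at h1
        exact Subtype.ext h1
    have hK : Nat.card g'.ker = p := by rw [hker']; exact hΦ.1
    obtain ⟨hrat, hnram⟩ := isRationalLine_range_and_not_unramified_of_ker_anomalousTwist hp3 hV hanom C hC g' hg' hK (hker' ▸ hu)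
    -- `g'(E[p]) = Ψ`: both are lines containing `q₀ ≠ 0`
    have hq₀range : q₀ ∈ g'.range := by
      refine ⟨⟨z, hzmem⟩, Subtype.ext ?_⟩
      rw [hg'val]; exact hgz
    have hrange : g'.range = Ψ := eq_of_prime_card_of_mem (p := p) hrat.1 hΨ.1 hq₀0 hq₀range hq₀Ψ
    exact hnram (hrange ▸ hunΨ)
  · ---------------------------------------------------------------- `p ∤ a`: `ℤy` is a bigger good subgroup
    -- `x ∈ ℤ y` (Bezout: `a` is a unit mod `p^k`)
    have hcop : IsCoprime ((p : ℤ) ^ k) a := (IsCoprime.pow_left ((Prime.coprime_iff_not_dvd hpz).mpr hdvd))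
    obtain ⟨u, v, huv⟩ := hcop
    have hxy : x ∈ AddSubgroup.zmultiples y := by
      have : x = v • ((p : ℤ) • y) := by
        calc x = (u * (p : ℤ) ^ k + v * a) • x := by rw [huv, one_smul]
          _ = u • (((p : ℤ) ^ k) • x) + v • (a • x) := by rw [add_smul, mul_smul, mul_smul]
          _ = v • ((p : ℤ) • y) := by rw [hpkx, smul_zero, zero_add, ha]
      rw [this, smul_smul]
      exact AddSubgroup.zsmul_mem _ (AddSubgroup.mem_zmultiples y) _
    -- `p^k y = a t ≠ 0` lies in `Φ'`, and `p^{k+1} y = 0`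
    have hpky : p ^ k • y = a • t := by
      have hk' : k = (k - 1) + 1 := by omega
      calc p ^ k • y = ((p : ℤ) ^ (k - 1) * (p : ℤ)) • y := by
              rw [← natCast_zsmul, Nat.cast_pow, ← pow_succ, ← hk']
        _ = ((p : ℤ) ^ (k - 1) * a) • x := by rw [mul_smul ((p : ℤ) ^ (k - 1)) (p : ℤ) y, ← ha, ← mul_smul]
        _ = a • t := by rw [mul_comm, mul_smul, ht, ← natCast_zsmul x (p ^ (k - 1)), Nat.cast_pow]
    have hat0 : a • t ≠ 0 := by
      intro h0
      apply hdvd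
      have := addOrderOf_dvd_iff_zsmul_eq_zero.mpr h0
      rwa [htord] at this
    have hpk1y : p ^ (k + 1) • y = 0 := by
      calc p ^ (k + 1) • y = p • (p ^ k • y) := by rw [pow_succ', mul_smul]
        _ = p • (a • t) := by rw [hpky]
        _ = a • (p • t) := smul_comm _ _ _
        _ = 0 := by rw [← htord, addOrderOf_nsmul_eq_zero, smul_zero]
    have hyord : addOrderOf y = p ^ (k + 1) :=
      addOrderOf_eq_prime_pow (by rw [hpky]; exact hat0) hpk1y
    -- `ℤ y` is `Γ_ℚ`-stable: `g(σ y) = σ q₀ = m q₀ = g(m y)`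
    have hystab : ∀ σ : absoluteGaloisGroup ℚ, σ • y ∈ AddSubgroup.zmultiples y := by
      intro σ
      have hσq : σ • q₀ ∈ AddSubgroup.zmultiples q₀ := by rw [hq₀gen]; exact hΨ.2 σ q₀ hq₀Ψ
      obtain ⟨m, hm⟩ := AddSubgroup.mem_zmultiples_iff.mp hσq
      have hdiff : σ • y - m • y ∈ g.toAddMonoidHom.ker := by
        rw [AddMonoidHom.mem_ker, map_sub, map_zsmul, Isogeny.coe_toAddMonoidHom, Isogeny.map_smul, hy,
          ← AddSubgroup.torsionBy.coe_smul, ← hm]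
        simp
      rw [hker] at hdiff
      have hsub : AddSubgroup.zmultiples x ≤ AddSubgroup.zmultiples y := AddSubgroup.zmultiples_le_of_mem hxy
      have := hsub hdiff
      have h2 : σ • y = (σ • y - m • y) + m • y := by abel
      rw [h2]
      exact AddSubgroup.add_mem _ this (AddSubgroup.zsmul_mem _ (AddSubgroup.mem_zmultiples y) m)
    -- hence `k + 1` is a good order: contradiction with maximality
    have hmem : k + 1 ∈ T := by
      refine ⟨y, hyord, hystab, ?_, ?_⟩
      · rw [Nat.add_sub_cancel, hpky, ← htgen]
        exact AddSubgroup.zsmul_mem _ (AddSubgroup.mem_zmultiples t) a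
      · rw [Nat.add_sub_cancel, hpky]; exact hat0
    have : k + 1 ≤ k := hk ▸ le_csSup hbdd hmem
    omega


/-! ### §3 The Keller–Yin-normalised member exists -/

omit [V.IsElliptic] [V.IsGloballyMinimal] [W.IsElliptic] [W.IsGloballyMinimal] in
/-- A `D_𝔓`-trivial rational line is unramified (`I_𝔓 ≤ D_𝔓`). [cite: NeukirchANT1999, Ch. I §9 Def. (9.5)] -/
theorem lineUnramifiedAt_of_lineDecompositionTrivialAt {W₁ : WeierstrassCurve ℚ} {Φ : AddSubgroup (geomTorsion W₁ (p : ℤ))}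
    (h : LineDecompositionTrivialAt W₁ p Φ) : LineUnramifiedAt W₁ p Φ :=
  fun v hv 𝔓 h𝔓 σ hσ P hP ↦ h v hv 𝔓 h𝔓 σ (Ideal.inertia_le_decompositionSubgroup _ _ hσ) P hP

/-- **THE KELLER–YIN-NORMALISED MEMBER EXISTS.**  For `W/ℚ` globally minimal with an anomalous good-ordinary twist model `W = C • V^{(3*)}`
(`V` globally minimal, `GoodOrd V 3`, `3 ∣ a₃(V) − 1`): there is a globally minimal `W₁`, `ℚ`-isogenous to `W`, EVERY rational `3`-line of which is
`D₃`-non-trivial — Keller–Yin arXiv:2410.23241's standing choice of lattice (Assumption 2.0.3 / §3.3), the per-lattice hypothesis `hnorm` of FILES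
11–15, is attainable in every isogeny class of the anomalous (G-ord, `e = 2`) sub-cell.  §2 + §3's first lemma.  UNCONDITIONAL.
[cite: KellerYin2024b, Assumption 2.0.3 / §3.3 standing normalisation (arXiv:2410.23241 p. 8)] [cite: Ribet1976, Prop. 2.1]
[cite: KellerYin2024, Prop. 1.3.1 (arXiv:2402.12781v2)] [cite: SilvermanAEC2009, Prop. III.4.12, Cor. IX.6.2] -/
theorem exists_isIsogenous_normalised_of_anomalousTwist (hp3 : p = 3) (hV : GoodOrd V p)
    (hanom : (p : ℤ) ∣ V.frobeniusTrace p - 1) (C : VariableChange ℚ) (hC : C • V.quadraticTwist ((-1 : ℚ) ^ (p / 2) * p) = W) :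
    ∃ (W₁ : WeierstrassCurve ℚ) (_ : W₁.IsElliptic) (_ : W₁.IsGloballyMinimal),
      IsIsogenous W W₁ ∧
        ∀ Φ : AddSubgroup (geomTorsion W₁ (p : ℤ)), IsRationalLine W₁ p Φ → ¬ LineDecompositionTrivialAt W₁ p Φ := by
  obtain ⟨W₁, hE₁, hmin₁, hiso, hno⟩ := exists_isIsogenous_noUnramifiedLine_of_anomalousTwist hp3 hV hanom C hC
  exact ⟨W₁, hE₁, hmin₁, hiso, fun Φ hΦ hD ↦ hno Φ hΦ (lineUnramifiedAt_of_lineDecompositionTrivialAt hD)⟩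

end Summit.BirchSwinnertonDyer.BirchSwinnertonDyer.Theorems.SchneiderFreeAdditiveX3.AnomalousTwistNormalisedMember

end
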